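import Literature.AlgebraicGeometry.Resolution.RegularRestrictionLocal
import Literature.AlgebraicGeometry.Resolution.BlowupStrictTransform
import Literature.AlgebraicGeometry.Resolution.HypersurfaceRestrictionTransform
import Literature.AlgebraicGeometry.Resolution.ColonIdealSheafFG
import Literature.AlgebraicGeometry.Resolution.BlowupsProduct
import HarnessLib

/-!
# Blowing up a scheme that retracts onto a closed subscheme through the centre

Topic: `Literature/AlgebraicGeometry/Resolution`. Theorem-only file (sorry-free, no named fact), over the tree's
blow-ups by the universal property (`IsBlowup`, `Blowups.lean`), controlled transforms
(`controlledTransform π C I b = (π^*I : 𝓘(E)^b)`, `MarkedIdeals.lean`) and strict transforms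
(`IsBlowup.strictTransformHom`; `RestrictionPropertyCartier.lean`, `RegularRestrictionLocal.lean`).

**Setting.** `k : W ⟶ X` a closed immersion with a RETRACTION `r : X ⟶ W`, `k ≫ r = 𝟙 W` (e.g. `X = 𝔸ⁿ × W`, or an
étale neighbourhood of a point of a smooth subvariety carrying a retraction); a centre `C ⊇ ker k` (`V(C) ⊆ W`);
`π : X' ⟶ X` a blow-up along `C`, `ρ : W' ⟶ W` a blow-up along `C|_W = C.comap k`, `j = Bl_C(k) : W' ⟶ X'` the strict
transform. Everything is proved from the universal property and the ideal-sheaf calculus; NO regularity or Noetherian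
hypothesis except in the last section, which rewrites `(π^*(ker k) : 𝓘(E))` as `ker j` by the tree's regular-pair
theorem `IsBlowup.ker_strictTransformHom_of_isRegular` (BGMW §4 Remark (3)).

* `ker_sup_comap_retract_eq` — **the centre splits**: `C = ker k ⊔ r^*(C|_W)`, `r^*(C|_W) = C.comap (r ≫ k)`.
* `IsBlowup.controlledTransform_ker_sup_controlledTransform_cylinder_eq_top` — **the two transforms cover**:
  `(π^*(ker k) : 𝓘(E)) ⊔ (π^*r^*(C|_W) : 𝓘(E)) = ⊤` (cancel the effective Cartier divisor `𝓘(E)` from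
  `𝓘(E)·⊤ = π^*C = 𝓘(E)·(–) ⊔ 𝓘(E)·(–)`).
* `retractLiftOpen` — the open `U ⊆ X'` off the support of `(π^*r^*(C|_W) : 𝓘(E))`; `IsBlowup.retractLift` — **on `U`
  the retraction lifts** to `r' : U ⟶ W'`, `r' ≫ ρ = (U ↪ X') ≫ π ≫ r` (GW Prop. 13.91 (1));
  `IsBlowup.comap_exceptional_retractLift` — `r'^*𝓘(E_W) = 𝓘(E)|_U`.
* `IsBlowup.controlledTransform_ker_one_le_ker_strictTransformHom` — `(π^*(ker k) : 𝓘(E)) ≤ ker j`; hence **the strict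
  transform lies in `U`** (`IsBlowup.range_strictTransformHom_subset_retractLiftOpen`), giving the closed immersion
  `j' : W' ⟶ U` (`IsBlowup.strictTransformHomRes`, `…_ι`, `IsBlowup.isClosedImmersion_strictTransformHomRes`,
  `IsBlowup.ker_strictTransformHomRes : ker j' = (ker j)|_U`) with **`j' ≫ r' = 𝟙 W'`**
  (`IsBlowup.strictTransformHomRes_retractLift`): `(U ⊇ W', r')` is again a retraction datum.
* **`IsBlowup.comap_controlledTransform_retract` — the transform law**: for `I` on `W` with `I ⊆ (C|_W)^b` and
  `J := r^*I + (ker k)^b`: `σᶜ_π(J, b)|_U = r'^* σᶜ_ρ(I, b) ⊔ ((π^*(ker k) : 𝓘(E))^b)|_U`; and on all of `X'`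
  `(π^*(ker k) : 𝓘(E))^b ≤ σᶜ_π(J, b)` (`IsBlowup.controlledTransform_ker_one_pow_le`), so the support of `σᶜ_π(J, b)`
  lies in `U` (`IsBlowup.support_controlledTransform_retract_subset`).
* Regular case (`X` regular locally Noetherian, `V(C)`, `W` regular): `IsBlowup.comap_controlledTransform_retract_of_isRegular`
  — `σᶜ_π(r^*I + 𝓘_W^b, b)|_U = r'^*σᶜ_ρ(I, b) ⊔ 𝓘_{W'}^b`, `𝓘_{W'} = ker j'`; `IsBlowup.ker_strictTransformHom_pow_le_of_isRegular`.

This is the blow-up step of the classical retraction model `J = r^*I + 𝓘_W^b` extending an ideal with exponent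
`(I, b)` from a smooth subvariety `W` to the ambient scheme; the model's order computation and its étale-local
existence are not in this file. Statements are elementary consequences (folklore) of the cited definitions, in the vocabulary of GW I (13.19) and
BGMW 2011 §3.2, §4; the transform law is not printed in this form in either source.

## Sources

* U. Görtz, T. Wedhorn, *Algebraic Geometry I*, 2nd ed. (2020), Def. 13.90, Prop. 13.91, Prop. 13.96 (pp. 413–416).
  [GortzWedhorn2020]
* E. Bierstone, D. Grigoriev, P. Milman, J. Włodarczyk, *Effective Hironaka resolution and its complexity*,
  arXiv:1206.3090, §3.2 Lemma 3.2.1, §4 Remark (3). [BierstoneGrigorievMilmanWlodarczyk2011]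
-/

noncomputable section

open CategoryTheory CategoryTheory.Limits AlgebraicGeometry TopologicalSpace

namespace Literature.AlgebraicGeometry.Resolution

universe u

section Prelim

variable {X Y : Scheme.{u}}

/-- `J` pulls back to the zero ideal along `f` iff `J ⊆ ker f` (Galois connection `comap ⊣ map`). [folklore] -/
private theorem comap_eq_bot_iff_le_ker (J : Y.IdealSheafData) (f : X ⟶ Y) : J.comap f = ⊥ ↔ J ≤ f.ker := by
  rw [← le_bot_iff, (Scheme.IdealSheafData.map_gc f).le_iff_le, Scheme.IdealSheafData.map_bot]
/-- Products of ideal sheaves distribute over `⊔`. [folklore] -/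
private theorem IdealSheafData.mul_sup (P K L : X.IdealSheafData) : P * (K ⊔ L) = P * K ⊔ P * L := by
  simpa only [add_eq_sup] using mul_add P K L

/-- `P · ⊥ = ⊥` for ideal sheaves. [folklore] -/
private theorem IdealSheafData.mul_bot (P : X.IdealSheafData) : P * ⊥ = ⊥ := by
  simpa only [bot_eq_zero] using mul_zero P

/-- An ideal sheaf restricted to an open subset disjoint from its support is the unit ideal. [folklore] -/
private theorem comap_ι_eq_top_of_disjoint_support (I : X.IdealSheafData) (U : X.Opens)
    (hU : (U : Set X) ⊆ (I.support : Set X)ᶜ) : I.comap U.ι = ⊤ := by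
  rw [← Scheme.IdealSheafData.support_eq_bot_iff, Scheme.IdealSheafData.support_comap]
  ext u
  simp only [Closeds.coe_preimage, Set.mem_preimage, Closeds.coe_bot, Set.mem_empty_iff_false, iff_false]
  exact hU u.2

end Prelim

/-! ## The centre splits: `C = ker k ⊔ r^*(C|_W)` -/

section Retract

variable {X W : Scheme.{u}} {k : W ⟶ X} [IsClosedImmersion k] {r : X ⟶ W} {C : X.IdealSheafData}

/-- **The centre splits along a retraction.** For a closed immersion `k : W ⟶ X` with retraction `r`
(`k ≫ r = 𝟙`) and an ideal `C ⊇ ker k` (`V(C) ⊆ W`): `C = ker k ⊔ r^*(C|_W)`, where `r^*(C|_W) = C.comap (r ≫ k)`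
is the ideal of the cylinder `r⁻¹(V(C))` — the schematic intersection `W ∩ r⁻¹(V(C))` is `V(C)` (GW I (4.11), inverse
images and schematic intersections of subschemes, with (4.11.1)). Both inclusions are checked by pulling back to `V(C)`
resp. `V(ker k ⊔ r^*(C|_W))`, closed subschemes of `W` on which `r ≫ k` restricts to the inclusion.
[cite: GortzWedhorn2020, (4.11) with (4.11.1), p. 112] -/
theorem ker_sup_comap_retract_eq (hkr : k ≫ r = 𝟙 W) (hCk : k.ker ≤ C) :
    k.ker ⊔ C.comap (r ≫ k) = C := by
  apply le_antisymm
  · refine sup_le hCk ?_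
    set m : C.subscheme ⟶ W := IsClosedImmersion.lift k C.subschemeι (by rwa [Scheme.IdealSheafData.ker_subschemeι])
    have hmk : m ≫ k = C.subschemeι := IsClosedImmersion.lift_fac _ _ _
    have hfix : C.subschemeι ≫ r ≫ k = C.subschemeι := by rw [← hmk, Category.assoc, reassoc_of% hkr]
    rw [← Scheme.IdealSheafData.ker_subschemeι (I := C), ← comap_eq_bot_iff_le_ker,
      ← Scheme.IdealSheafData.comap_comp, Scheme.IdealSheafData.ker_subschemeι, hfix,
      comap_eq_bot_iff_le_ker, Scheme.IdealSheafData.ker_subschemeι]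
  · set J : X.IdealSheafData := k.ker ⊔ C.comap (r ≫ k)
    have hkJ : k.ker ≤ J.subschemeι.ker := by rw [Scheme.IdealSheafData.ker_subschemeι]; exact le_sup_left
    set m' : J.subscheme ⟶ W := IsClosedImmersion.lift k J.subschemeι hkJ
    have hm'k : m' ≫ k = J.subschemeι := IsClosedImmersion.lift_fac _ _ _
    have hm'r : J.subschemeι ≫ r = m' := by rw [← hm'k, Category.assoc, hkr, Category.comp_id]
    rw [← Scheme.IdealSheafData.ker_subschemeι (I := J), ← comap_eq_bot_iff_le_ker, ← hm'k,
      Scheme.IdealSheafData.comap_comp, ← hm'r, Scheme.IdealSheafData.comap_comp,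
      ← Scheme.IdealSheafData.comap_comp C r k, comap_eq_bot_iff_le_ker, Scheme.IdealSheafData.ker_subschemeι]
    exact le_sup_right

/-- `r^*(C|_W) ⊆ C`. [folklore] -/
private theorem comap_retract_le (hkr : k ≫ r = 𝟙 W) (hCk : k.ker ≤ C) : C.comap (r ≫ k) ≤ C :=
  le_sup_right.trans_eq (ker_sup_comap_retract_eq hkr hCk)

end Retract

/-! ## The two transforms cover the blow-up; the open `U` where the retraction lifts -/

section Blowup

variable {X X' W W' : Scheme.{u}}

/-- **The open `U ⊆ X'` on which the retraction lifts**: the complement of the support of `(π^*r^*(C|_W) : 𝓘(E))`,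
i.e. the locus where the pulled-back equations of the centre INSIDE `W` already generate the exceptional ideal —
the open on which GW Prop. 13.91 (1) produces the lifted retraction. [cite: GortzWedhorn2020, Prop. 13.91 (1), p. 413] -/
def retractLiftOpen (π : X' ⟶ X) (C : X.IdealSheafData) (k : W ⟶ X) (r : X ⟶ W) : X'.Opens :=
  (controlledTransform π C (C.comap (r ≫ k)) 1).support.compl

variable {k : W ⟶ X} [IsClosedImmersion k] {r : X ⟶ W} {C : X.IdealSheafData} {π : X' ⟶ X} {ρ : W' ⟶ W}

/-- For a blow-up `π` along `C` and `K ⊆ C`: `𝓘(E) · (π^*K : 𝓘(E)) = π^*K` (the exceptional ideal divides `π^*K` once).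
[cite: BierstoneGrigorievMilmanWlodarczyk2011, §3.2 Lemma 3.2.1] -/
theorem IsBlowup.comap_mul_controlledTransform_one (hπ : IsBlowup π C) {K : X.IdealSheafData} (hK : K ≤ C) :
    C.comap π * controlledTransform π C K 1 = K.comap π := by
  simpa only [pow_one] using
    hπ.pow_mul_controlledTransform_eq (I := K) (μ := 1) (by rw [pow_one]; exact Scheme.IdealSheafData.comap_mono _ hK)

/-- **The two transforms cover the blow-up.** In the retraction setting (`k ≫ r = 𝟙`, `ker k ⊆ C`), for a blow-up `π`
along `C`: `(π^*(ker k) : 𝓘(E)) ⊔ (π^*r^*(C|_W) : 𝓘(E)) = ⊤` — at every point of `X'` the (invertible) exceptional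
ideal `𝓘(E) = π^*(ker k) + π^*r^*(C|_W)` (GW (4.11.1) applied to `C = ker k ⊔ r^*(C|_W)`) is generated by one of the two
summands; proved by cancelling the effective Cartier divisor `𝓘(E)` (GW Def. 13.90) from BGMW Lemma 3.2.1's
factorisations `π^*K = 𝓘(E)·(π^*K : 𝓘(E))`. [cite: GortzWedhorn2020, Def. 13.90 with (4.11.1), pp. 413, 112] -/
theorem IsBlowup.controlledTransform_ker_sup_controlledTransform_cylinder_eq_top (hπ : IsBlowup π C)
    (hkr : k ≫ r = 𝟙 W) (hCk : k.ker ≤ C) :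
    controlledTransform π C k.ker 1 ⊔ controlledTransform π C (C.comap (r ≫ k)) 1 = ⊤ := by
  apply hπ.isEffectiveCartier.eq_of_mul_eq_mul
  rw [IdealSheafData.mul_sup, hπ.comap_mul_controlledTransform_one hCk,
    hπ.comap_mul_controlledTransform_one (comap_retract_le hkr hCk), ← Scheme.IdealSheafData.comap_sup,
    ker_sup_comap_retract_eq hkr hCk, ← Scheme.IdealSheafData.one_eq_top, mul_one]

/-- The supports of the two transforms are disjoint. [folklore] -/
private theorem IsBlowup.support_controlledTransform_ker_inter_eq_empty (hπ : IsBlowup π C) (hkr : k ≫ r = 𝟙 W)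
    (hCk : k.ker ≤ C) :
    ((controlledTransform π C k.ker 1).support : Set X') ∩
      (controlledTransform π C (C.comap (r ≫ k)) 1).support = ∅ := by
  have h := congrArg (fun I : X'.IdealSheafData => (I.support : Set X'))
    (hπ.controlledTransform_ker_sup_controlledTransform_cylinder_eq_top hkr hCk)
  simpa only [Scheme.IdealSheafData.support_sup, Closeds.coe_inf, Scheme.IdealSheafData.support_top,
    Closeds.coe_bot] using h

omit [IsClosedImmersion k] in
/-- On `U` the transform `(π^*r^*(C|_W) : 𝓘(E))` is the unit ideal. [folklore] -/
private theorem controlledTransform_cylinder_comap_ι_retractLiftOpen :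
    (controlledTransform π C (C.comap (r ≫ k)) 1).comap (retractLiftOpen π C k r).ι = ⊤ :=
  comap_ι_eq_top_of_disjoint_support _ _ fun _ hx => hx

/-- **On `U`, `π^*r^*(C|_W) = 𝓘(E)`**: the centre of `ρ`, pulled back along `U ↪ X' → X → W`, is the exceptional
ideal restricted to `U` — an effective Cartier divisor, so that GW Prop. 13.91 (1) / Def. 13.90 apply to `U → W`.
[cite: GortzWedhorn2020, Prop. 13.91 (1), p. 413] -/
theorem IsBlowup.comap_cylinder_retractLiftOpen (hπ : IsBlowup π C) (hkr : k ≫ r = 𝟙 W) (hCk : k.ker ≤ C) :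
    (C.comap k).comap ((retractLiftOpen π C k r).ι ≫ π ≫ r) =
      (C.comap π).comap (retractLiftOpen π C k r).ι := by
  rw [← Category.assoc, Scheme.IdealSheafData.comap_comp, ← Scheme.IdealSheafData.comap_comp C r k,
    Scheme.IdealSheafData.comap_comp, ← hπ.comap_mul_controlledTransform_one (comap_retract_le hkr hCk),
    comap_mul, controlledTransform_cylinder_comap_ι_retractLiftOpen, ← Scheme.IdealSheafData.one_eq_top, mul_one]

/-- **The lifted retraction `r' : U ⟶ W'`** = GW Prop. 13.91 (1)'s `Bl_{C|_W}(f)` for `f : U ↪ X' → X → W`, where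
`Bl_{f⁻¹(C|_W)}(U) = U` as `f` pulls the centre back to the effective Cartier divisor `𝓘(E)|_U` (universal property of
`ρ`, GW Def. 13.90). [cite: GortzWedhorn2020, Prop. 13.91 (1), p. 413] -/
def IsBlowup.retractLift (hπ : IsBlowup π C) (hρ : IsBlowup ρ (C.comap k)) (hkr : k ≫ r = 𝟙 W)
    (hCk : k.ker ≤ C) : (retractLiftOpen π C k r : Scheme.{u}) ⟶ W' :=
  hρ.lift ((retractLiftOpen π C k r).ι ≫ π ≫ r)
    (by rw [hπ.comap_cylinder_retractLiftOpen hkr hCk]; exact hπ.isEffectiveCartier.comap_ι _)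

/-- `r'` lies over `r`: `r' ≫ ρ = (U ↪ X') ≫ π ≫ r` (the commutative square (13.19.1)).
[cite: GortzWedhorn2020, Prop. 13.91 (1), (13.19.1), p. 413] -/
@[reassoc (attr := simp)]
theorem IsBlowup.retractLift_comp (hπ : IsBlowup π C) (hρ : IsBlowup ρ (C.comap k)) (hkr : k ≫ r = 𝟙 W)
    (hCk : k.ker ≤ C) :
    hπ.retractLift hρ hkr hCk ≫ ρ = (retractLiftOpen π C k r).ι ≫ π ≫ r :=
  hρ.lift_comp _ _

/-- **`r'^*𝓘(E_W) = 𝓘(E)|_U`**: the exceptional divisor of `ρ` pulls back along the lifted retraction to the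
exceptional divisor of `π` restricted to `U` (as in the proof of GW Prop. 13.91 (2): «`E'` is also the inverse image of
`f⁻¹(Z)`»). [cite: GortzWedhorn2020, Prop. 13.91 (1)–(2), p. 413] -/
theorem IsBlowup.comap_exceptional_retractLift (hπ : IsBlowup π C) (hρ : IsBlowup ρ (C.comap k))
    (hkr : k ≫ r = 𝟙 W) (hCk : k.ker ≤ C) :
    ((C.comap k).comap ρ).comap (hπ.retractLift hρ hkr hCk) = (C.comap π).comap (retractLiftOpen π C k r).ι := by
  rw [← Scheme.IdealSheafData.comap_comp, hπ.retractLift_comp, hπ.comap_cylinder_retractLiftOpen hkr hCk]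

end Blowup

/-! ## The strict transform lies in `U` and is retracted by `r'` -/

section Strict

variable {X X' W W' : Scheme.{u}} {k : W ⟶ X} [IsClosedImmersion k] {r : X ⟶ W} {C : X.IdealSheafData}
  {π : X' ⟶ X} {ρ : W' ⟶ W}

omit [IsClosedImmersion k] in
/-- **`(π^*(ker k) : 𝓘(E)) ⊆ ker Bl_C(k)`** for any `k` through the centre (`ker k ⊆ C`) and the strict transform
`j = Bl_C(k) : W' → X'` (GW Prop. 13.91 (1) for `k`, a closed immersion by Prop. 13.96 (2); the strict transform is the
schematic closure of `π⁻¹(W ∖ V(C))`, (13.19) p. 414): `j^*π^*(ker k) = ρ^*k^*(ker k) = 0` and `j^*𝓘(E) = 𝓘(E_W)` is an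
effective Cartier divisor, which cancels. (Equality for a regular pair: `IsBlowup.ker_strictTransformHom_of_isRegular`.)
[cite: GortzWedhorn2020, Prop. 13.96 (2) with (13.19) p. 414] -/
theorem IsBlowup.controlledTransform_ker_one_le_ker_strictTransformHom (hπ : IsBlowup π C)
    (hρ : IsBlowup ρ (C.comap k)) (hCk : k.ker ≤ C) :
    controlledTransform π C k.ker 1 ≤ (hπ.strictTransformHom hρ).ker := by
  have h0 : (k.ker.comap π).comap (hπ.strictTransformHom hρ) = ⊥ := by
    rw [← Scheme.IdealSheafData.comap_comp, hπ.strictTransformHom_comp, Scheme.IdealSheafData.comap_comp,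
      (comap_eq_bot_iff_le_ker k.ker k).mpr le_rfl, Scheme.IdealSheafData.comap_bot]
  have hE : IsEffectiveCartier ((C.comap π).comap (hπ.strictTransformHom hρ)) := by
    rw [← Scheme.IdealSheafData.comap_comp, hπ.strictTransformHom_comp, Scheme.IdealSheafData.comap_comp]
    exact hρ.isEffectiveCartier
  rw [← comap_eq_bot_iff_le_ker]
  apply hE.eq_of_mul_eq_mul
  rw [IdealSheafData.mul_bot, ← comap_mul, hπ.comap_mul_controlledTransform_one hCk, h0]

/-- **The strict transform lies in `U`** (its image is contained in the support of `(π^*(ker k) : 𝓘(E))`, which misses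
the support of `(π^*r^*(C|_W) : 𝓘(E))`). [cite: GortzWedhorn2020, Prop. 13.96 (2), p. 416] -/
theorem IsBlowup.range_strictTransformHom_subset_retractLiftOpen (hπ : IsBlowup π C)
    (hρ : IsBlowup ρ (C.comap k)) (hkr : k ≫ r = 𝟙 W) (hCk : k.ker ≤ C) :
    Set.range (hπ.strictTransformHom hρ) ⊆ (retractLiftOpen π C k r : Set X') := by
  intro x hx
  have h1 : x ∈ ((controlledTransform π C k.ker 1).support : Set X') :=
    Scheme.IdealSheafData.support_antitone (hπ.controlledTransform_ker_one_le_ker_strictTransformHom hρ hCk)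
      ((hπ.strictTransformHom hρ).range_subset_ker_support hx)
  exact fun h2 => (Set.ext_iff.mp (hπ.support_controlledTransform_ker_inter_eq_empty hkr hCk) x).mp ⟨h1, h2⟩

/-- **The strict transform as a morphism `j' : W' ⟶ U`** (`Bl_C(k)` of GW Prop. 13.91 (1) / 13.96 (2), corestricted to
the open `U ⊇ Bl_C(k)(W')`). [cite: GortzWedhorn2020, Prop. 13.96 (2), p. 416] -/
def IsBlowup.strictTransformHomRes (hπ : IsBlowup π C) (hρ : IsBlowup ρ (C.comap k)) (hkr : k ≫ r = 𝟙 W)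
    (hCk : k.ker ≤ C) : W' ⟶ (retractLiftOpen π C k r : Scheme.{u}) :=
  IsOpenImmersion.lift (retractLiftOpen π C k r).ι (hπ.strictTransformHom hρ)
    (by rw [Scheme.Opens.range_ι]; exact hπ.range_strictTransformHom_subset_retractLiftOpen hρ hkr hCk)

/-- `j' ≫ (U ↪ X') = j`. [cite: GortzWedhorn2020, Prop. 13.96 (2), p. 416] -/
@[reassoc (attr := simp)]
theorem IsBlowup.strictTransformHomRes_ι (hπ : IsBlowup π C) (hρ : IsBlowup ρ (C.comap k)) (hkr : k ≫ r = 𝟙 W)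
    (hCk : k.ker ≤ C) :
    hπ.strictTransformHomRes hρ hkr hCk ≫ (retractLiftOpen π C k r).ι = hπ.strictTransformHom hρ :=
  IsOpenImmersion.lift_fac _ _ _

/-- `j'` is a closed immersion (as `j` is, GW I Prop. 13.96 (2), tree theorem `IsBlowup.isClosedImmersion_of_comp_eq`,
and `U ↪ X'` is separated). [cite: GortzWedhorn2020, Prop. 13.96 (2)] -/
theorem IsBlowup.isClosedImmersion_strictTransformHomRes (hπ : IsBlowup π C) (hρ : IsBlowup ρ (C.comap k))
    (hkr : k ≫ r = 𝟙 W) (hCk : k.ker ≤ C) : IsClosedImmersion (hπ.strictTransformHomRes hρ hkr hCk) := by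
  haveI : IsClosedImmersion (hπ.strictTransformHomRes hρ hkr hCk ≫ (retractLiftOpen π C k r).ι) := by
    rw [hπ.strictTransformHomRes_ι]
    exact hπ.isClosedImmersion_of_comp_eq hρ (hπ.strictTransformHom_comp hρ)
  exact IsClosedImmersion.of_comp _ (retractLiftOpen π C k r).ι

/-- **`ker j' = (ker j)|_U`**: the ideal of the strict transform inside `U` is the restriction of its ideal in `X'`
(`W'` is the pull-back of `j` along `U ↪ X'`). [cite: GortzWedhorn2020, Prop. 13.96 (2), p. 416] -/
theorem IsBlowup.ker_strictTransformHomRes (hπ : IsBlowup π C) (hρ : IsBlowup ρ (C.comap k))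
    (hkr : k ≫ r = 𝟙 W) (hCk : k.ker ≤ C) :
    (hπ.strictTransformHomRes hρ hkr hCk).ker =
      (hπ.strictTransformHom hρ).ker.comap (retractLiftOpen π C k r).ι := by
  haveI := hπ.isClosedImmersion_of_comp_eq hρ (hπ.strictTransformHom_comp hρ)
  have H : IsPullback (hπ.strictTransformHomRes hρ hkr hCk) (𝟙 _) (retractLiftOpen π C k r).ι
      (hπ.strictTransformHom hρ) :=
    IsOpenImmersion.isPullback_lift_id _ _ _
  rw [← H.isoPullback_hom_fst, Scheme.Hom.ker_comp_of_isIso, Scheme.IdealSheafData.ker_fst_of_isClosedImmersion]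

/-- **`r'` retracts the strict transform**: `j' ≫ r' = 𝟙 W'` — both sides are endomorphisms of the blow-up `W'` over
`W` (`j ≫ π ≫ r = ρ ≫ k ≫ r = ρ`), i.e. the uniqueness in GW Prop. 13.91 (1): `Bl(r) ∘ Bl(k) = Bl(r ∘ k) = Bl(id)`.
[cite: GortzWedhorn2020, Prop. 13.91 (1), p. 413] -/
theorem IsBlowup.strictTransformHomRes_retractLift (hπ : IsBlowup π C) (hρ : IsBlowup ρ (C.comap k))
    (hkr : k ≫ r = 𝟙 W) (hCk : k.ker ≤ C) :
    hπ.strictTransformHomRes hρ hkr hCk ≫ hπ.retractLift hρ hkr hCk = 𝟙 W' := by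
  apply hρ.eq_id_of_comp_eq
  rw [Category.assoc, hπ.retractLift_comp, hπ.strictTransformHomRes_ι_assoc, hπ.strictTransformHom_comp_assoc,
    hkr, Category.comp_id]

end Strict

/-! ## The transform law -/

section TransformLaw

variable {X X' W W' : Scheme.{u}} {k : W ⟶ X} [IsClosedImmersion k] {r : X ⟶ W} {C : X.IdealSheafData}
  {π : X' ⟶ X} {ρ : W' ⟶ W}

/-- `r^*I + (ker k)^b ⊆ C^b` whenever `I ⊆ (C|_W)^b`. [folklore] -/
private theorem comap_retract_sup_ker_pow_le (hkr : k ≫ r = 𝟙 W) (hCk : k.ker ≤ C) {I : W.IdealSheafData} {b : ℕ}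
    (hI : I ≤ C.comap k ^ b) : I.comap r ⊔ k.ker ^ b ≤ C ^ b := by
  refine sup_le ?_ (pow_le_pow_left' hCk b)
  calc I.comap r ≤ (C.comap k ^ b).comap r := Scheme.IdealSheafData.comap_mono _ hI
    _ = C.comap (r ≫ k) ^ b := by rw [comap_pow, ← Scheme.IdealSheafData.comap_comp]
    _ ≤ C ^ b := pow_le_pow_left' (comap_retract_le hkr hCk) b

/-- **The transform law for the retraction model.** In the retraction setting (`k ≫ r = 𝟙 W`, `ker k ⊆ C`, blow-ups
`π` along `C` and `ρ` along `C|_W`, `U` and `r' : U → W'` as above), for every ideal sheaf `I` on `W` with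
`I ⊆ (C|_W)^b` and `J := r^*I + (ker k)^b`: `σᶜ_π(J, b)|_U = r'^* σᶜ_ρ(I, b) ⊔ ((π^*(ker k) : 𝓘(E))^b)|_U`. Proof:
`π^*J|_U = r'^*ρ^*I ⊔ (π^*ker k)^b|_U = 𝓘(E)^b|_U · (r'^*σᶜ_ρ(I,b) ⊔ (π^*(ker k) : 𝓘(E))^b|_U)` as `r'^*𝓘(E_W) = 𝓘(E)|_U`
and `π^*(ker k) = 𝓘(E)·(π^*(ker k) : 𝓘(E))`; also `π^*J = 𝓘(E)^b · σᶜ_π(J,b)` (BGMW Lemma 3.2.1: «`σ^*(𝓘)` is divisible by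
`𝓘(D)^μ`»); cancel the effective Cartier divisor `𝓘(E)^b|_U`. No regularity hypothesis; the statement is this file's
(an elementary consequence, not printed in this form). [cite: BierstoneGrigorievMilmanWlodarczyk2011, §3.2 Lemma 3.2.1] -/
theorem IsBlowup.comap_controlledTransform_retract (hπ : IsBlowup π C) (hρ : IsBlowup ρ (C.comap k))
    (hkr : k ≫ r = 𝟙 W) (hCk : k.ker ≤ C) {I : W.IdealSheafData} {b : ℕ} (hI : I ≤ C.comap k ^ b) :
    (controlledTransform π C (I.comap r ⊔ k.ker ^ b) b).comap (retractLiftOpen π C k r).ι =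
      (controlledTransform ρ (C.comap k) I b).comap (hπ.retractLift hρ hkr hCk) ⊔
        (controlledTransform π C k.ker 1 ^ b).comap (retractLiftOpen π C k r).ι := by
  have hJπ : C.comap π ^ b * controlledTransform π C (I.comap r ⊔ k.ker ^ b) b = (I.comap r ⊔ k.ker ^ b).comap π :=
    hπ.pow_mul_controlledTransform_eq
      ((Scheme.IdealSheafData.comap_mono _ (comap_retract_sup_ker_pow_le hkr hCk hI)).trans_eq (comap_pow π C b))
  have hIρ : (C.comap k).comap ρ ^ b * controlledTransform ρ (C.comap k) I b = I.comap ρ :=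
    hρ.pow_mul_controlledTransform_eq ((Scheme.IdealSheafData.comap_mono _ hI).trans_eq (comap_pow ρ _ b))
  have hA : ((I.comap r).comap π).comap (retractLiftOpen π C k r).ι =
      (C.comap π).comap (retractLiftOpen π C k r).ι ^ b *
        (controlledTransform ρ (C.comap k) I b).comap (hπ.retractLift hρ hkr hCk) := by
    rw [← Scheme.IdealSheafData.comap_comp, ← Scheme.IdealSheafData.comap_comp, Category.assoc,
      ← hπ.retractLift_comp hρ hkr hCk, Scheme.IdealSheafData.comap_comp, ← hIρ, comap_mul, comap_pow,
      hπ.comap_exceptional_retractLift hρ hkr hCk]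
  have hB : ((k.ker ^ b).comap π).comap (retractLiftOpen π C k r).ι =
      (C.comap π).comap (retractLiftOpen π C k r).ι ^ b *
        (controlledTransform π C k.ker 1 ^ b).comap (retractLiftOpen π C k r).ι := by
    rw [comap_pow, ← hπ.comap_mul_controlledTransform_one hCk, mul_pow, comap_mul, comap_pow]
  apply ((hπ.isEffectiveCartier.comap_ι (retractLiftOpen π C k r)).pow b).eq_of_mul_eq_mul
  rw [IdealSheafData.mul_sup, ← hA, ← hB, ← comap_pow, ← comap_mul, hJπ, Scheme.IdealSheafData.comap_sup,
    Scheme.IdealSheafData.comap_sup]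

/-- **`(π^*(ker k) : 𝓘(E))^b ⊆ σᶜ_π(J, b)` on all of `X'`** (`(ker k)^b ⊆ J`, transform and cancel `𝓘(E)^b`); in
particular `σᶜ_π(J, b)` is the unit ideal off the support of `(π^*(ker k) : 𝓘(E))` (the strict transform of `W`).
[cite: BierstoneGrigorievMilmanWlodarczyk2011, §3.2 Lemma 3.2.1] -/
theorem IsBlowup.controlledTransform_ker_one_pow_le (hπ : IsBlowup π C) (hkr : k ≫ r = 𝟙 W) (hCk : k.ker ≤ C)
    {I : W.IdealSheafData} {b : ℕ} (hI : I ≤ C.comap k ^ b) :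
    controlledTransform π C k.ker 1 ^ b ≤ controlledTransform π C (I.comap r ⊔ k.ker ^ b) b := by
  apply (hπ.isEffectiveCartier.pow b).le_of_mul_le_mul
  rw [hπ.pow_mul_controlledTransform_eq
      ((Scheme.IdealSheafData.comap_mono _ (comap_retract_sup_ker_pow_le hkr hCk hI)).trans_eq (comap_pow π C b)),
    ← mul_pow, hπ.comap_mul_controlledTransform_one hCk, ← comap_pow]
  exact Scheme.IdealSheafData.comap_mono _ le_sup_right

/-- **The support of `σᶜ_π(J, b)` lies in `U`** (indeed in the support of `(π^*(ker k) : 𝓘(E))`, which misses the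
support of `(π^*r^*(C|_W) : 𝓘(E))`), for `b ≥ 1`. [cite: BierstoneGrigorievMilmanWlodarczyk2011, §3.2 Lemma 3.2.1] -/
theorem IsBlowup.support_controlledTransform_retract_subset (hπ : IsBlowup π C) (hkr : k ≫ r = 𝟙 W)
    (hCk : k.ker ≤ C) {I : W.IdealSheafData} {b : ℕ} (hb : b ≠ 0) (hI : I ≤ C.comap k ^ b) :
    ((controlledTransform π C (I.comap r ⊔ k.ker ^ b) b).support : Set X') ⊆ retractLiftOpen π C k r := by
  intro x hx h2
  have h1 := Scheme.IdealSheafData.support_antitone (hπ.controlledTransform_ker_one_pow_le hkr hCk hI) hx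
  rw [Scheme.IdealSheafData.support_pow (hn := hb)] at h1
  exact (Set.ext_iff.mp (hπ.support_controlledTransform_ker_inter_eq_empty hkr hCk) x).mp ⟨h1, h2⟩

end TransformLaw

/-! ## The regular case: `(π^*(ker k) : 𝓘(E)) = ker Bl_C(k)` -/

section Regular

variable {X X' W W' : Scheme.{u}} [IsLocallyNoetherian X] {k : W ⟶ X} [IsClosedImmersion k] {r : X ⟶ W}
  {C : X.IdealSheafData} {π : X' ⟶ X} {ρ : W' ⟶ W}

/-- **The transform law, regular case**: `X` regular locally Noetherian, `V(C)` and `W` regular; then, on `U`,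
`σᶜ_π(r^*I + 𝓘_W^b, b)|_U = r'^* σᶜ_ρ(I, b) ⊔ 𝓘_{W'}^b` with `𝓘_{W'} = ker j'` the ideal of the strict transform
in `U` (`ker Bl_C(k) = (π^*𝓘_W : 𝓘(E))` by the tree's regular-pair theorem `IsBlowup.ker_strictTransformHom_of_isRegular`)
— the retraction model `r^*I + 𝓘_W^b` on `(X ⊇ W)` transforms into the retraction model `r'^*I' + 𝓘_{W'}^b` on
`(U ⊇ W')`, `I' = σᶜ_ρ(I, b)`. [cite: BierstoneGrigorievMilmanWlodarczyk2011, §4 Remark (3) with §3.2 Lemma 3.2.1] -/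
theorem IsBlowup.comap_controlledTransform_retract_of_isRegular (hX : Scheme.IsRegular X) (hπ : IsBlowup π C)
    (hρ : IsBlowup ρ (C.comap k)) (hkr : k ≫ r = 𝟙 W) (hCk : k.ker ≤ C) (hC : Scheme.IsRegular C.subscheme)
    (hW : Scheme.IsRegular k.ker.subscheme) {I : W.IdealSheafData} {b : ℕ} (hI : I ≤ C.comap k ^ b) :
    (controlledTransform π C (I.comap r ⊔ k.ker ^ b) b).comap (retractLiftOpen π C k r).ι =
      (controlledTransform ρ (C.comap k) I b).comap (hπ.retractLift hρ hkr hCk) ⊔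
        (hπ.strictTransformHomRes hρ hkr hCk).ker ^ b := by
  rw [hπ.ker_strictTransformHomRes hρ hkr hCk, ← comap_pow, hπ.ker_strictTransformHom_of_isRegular hX hC hρ hCk hW]
  exact hπ.comap_controlledTransform_retract hρ hkr hCk hI

/-- **`(ker Bl_C(k))^b ⊆ σᶜ_π(r^*I + 𝓘_W^b, b)`**, regular case.
[cite: BierstoneGrigorievMilmanWlodarczyk2011, §4 Remark (3) with §3.2 Lemma 3.2.1] -/
theorem IsBlowup.ker_strictTransformHom_pow_le_of_isRegular (hX : Scheme.IsRegular X) (hπ : IsBlowup π C)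
    (hρ : IsBlowup ρ (C.comap k)) (hkr : k ≫ r = 𝟙 W) (hCk : k.ker ≤ C) (hC : Scheme.IsRegular C.subscheme)
    (hW : Scheme.IsRegular k.ker.subscheme) {I : W.IdealSheafData} {b : ℕ} (hI : I ≤ C.comap k ^ b) :
    (hπ.strictTransformHom hρ).ker ^ b ≤ controlledTransform π C (I.comap r ⊔ k.ker ^ b) b := by
  rw [hπ.ker_strictTransformHom_of_isRegular hX hC hρ hCk hW]
  exact hπ.controlledTransform_ker_one_pow_le hkr hCk hI

end Regular

end Literature.AlgebraicGeometry.Resolution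

end
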